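import Summits.AtomisticToContinuum.BoseEinsteinCondensation.Theorems.GaussianDominationCan.Negative.LoadBearing
import Literature.MathematicalPhysics.QuantumManyBody.OneBodyCurrentGain
import HarnessLib

/-!
# Stub S4 `stub_normalisationLift : NormalisationLift` (line `ward-chord-splitting`, crux stmt-AtomisticToContinuum-9479)
# — worker analysis (for the lead to quote) and the kernel-checked algebraic skeleton of the lift

**VERDICT.** Not provable as stated. Every extra hypothesis that makes `CNumberGD → crux` provable is either the crux in
disguise (`SourceTransfer` below) or a condensation statement UNIFORM IN `L` that strictly contains
`BECPeriodicReduction.PeriodicBEC` (the route's own output): S4 is circular for route BECThomsonPrinciple.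

1. WHAT S4 ASKS (square forms: `forall_gdIneq_iff`, `sq_le_of_ennreal_chords`; `N = m+1`, `k̃ := ‖n‖∞/L`, `h(Φ) := E_v(Φ) − E₀`):
   `CNumberGD ⟺ |X(Φ)|² ≤ 4 C_X N h(Φ)/k̃²`, `X(Φ) = ⟨Φ, AΦ⟩`, `A := Σᵢ e^{ik·xᵢ}Pᵢ = a_k†a_0` (`A` lowers `n̂₀ := ΣᵢPᵢ` by one:
   `Pᵢ(e^{ik·xᵢ}·) = 0` for `k ≠ 0`; the `Pᵢ` are commuting self-adjoint idempotents, `cellAvg_comm/_cellAvg`, `integral_conj_mul_cellAvg`);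
   `crux ⟺ |N·I(Φ)|² ≤ C h(Φ)/k̃²`, `N·I(Φ) = ⟨Φ, Λ†Φ⟩` by `Φ.symm` (`∑ᵢ ↦ N×` particle 0, `gaussianDominationCan_false_without_symm`),
   `Λ† = A n̂₀^{-1/2} = (n̂₀+1)^{-1/2}A`.  Sectors `Φ = Σⱼ Φⱼ` (`n̂₀Φⱼ = jΦⱼ`), `Aⱼ := ⟨Φ_{j−1}, AΦⱼ⟩`:
   `X = Σⱼ Aⱼ`,  `N·I = Σⱼ j^{-1/2} Aⱼ`.  On a state with SHARP `n̂₀ = j ≥ x₀N`: `N·I = X/√j`, and `CNumberGD` at `s' = 2s/√j`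
   IS the crux with `C = 4C_X/x₀` (the brief's `4C/x`) — the Josephson factor `1/x₀`.
2. WHERE THE DIRECT PROOF STOPS. No inequality `|Σ j^{-1/2}Aⱼ| ≤ F(|ΣAⱼ|)` exists (`Aⱼ = (−1)ʲ` on a band: `X = 0 ≠ N·I`), so
   `CNumberGD` must be fed COMPARISON states. Exact identity: `Λ + Λ† = G(A + A†)G`, `G = g(n̂₀)`, `g(j)²g(j+1)² = 1/(j+1)`
   (`g(j)² = Γ(j/2+½)/(√2·Γ(j/2+1)) ≈ (j+½)^{-1/2}`); `CNumberGD` at `GΦ/‖GΦ‖` gives, for every `Φ` and `s`,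
       `⟨Φ, (H + s(Λ+Λ†))Φ⟩ ≥ E₀ + h(Φ) − 2s·√(4C_X N/k̃²)·‖GΦ‖·√h(GΦ)`,
   hence the crux at `Φ` ⟸ (★★) `h(GΦ)·‖GΦ‖² ≤ (C/(4 C_X N))·h(Φ)`.  With `Dⱼ := ⟨Φⱼ,(H−E₀)Φⱼ⟩`, `V_{jj'} := ⟨Φⱼ,VΦ_{j'}⟩`
   (`T` commutes with `n̂₀`; the pair interaction couples `j ↔ j±1, j±2` only):
       `h(GΦ) = Σⱼ g(j)²Dⱼ + 2Re Σ_{j'−j∈{1,2}} g(j)g(j')V_{jj'}`   versus   `h(Φ) = Σⱼ Dⱼ + 2Re Σ V_{jj'}`.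
   (★★) needs (a) `Φ` supported on `j ≥ x₀N` (`g⁴ ≤ 1/(x₀N)`, `C = 4C_X/x₀` again) AND (b) the reweighting error
   `Σ(g(j)²−ḡ²)Dⱼ + 2ReΣ(g(j)g(j')−ḡ²)V_{jj'}` to be `≤ (C/4C_XN)·h(Φ)`: but `Dⱼ`, `V_{jj'}` are individually of the size of the
   pairing energy `|E_pair| = |2Re⟨V₊₂⟩_{Ψ₀}| ≈ ρN(v̂(0)−8πa)` (Bogoliubov; `≳ E₀` unless `v` is soft), cancelling only in the sum;
   across the `n̂₀`-width `σ` of `Φ` the weights vary by `σ/(2j)`. At `Φ = Ψ₀` exactly: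
   `h(GΨ₀)‖GΨ₀‖² = ½⟨[G,[V,G]]⟩_{Ψ₀}‖GΨ₀‖² ≈ |E_pair|/(8x³N³) > 0 = h(Ψ₀)` —
   (★★) FAILS AT THE GROUND STATE (the loss is the discarded selection rule `⟨Λ†⟩_{Ψ₀} = 0`). This is where `σ` enters.
3. MOMENTUM-RESOLVED FORM (the most `CNumberGD` can give). Polarising `CNumberGD` across total-momentum sectors `P`, `P+k`
   (translation averages of trial states are trial states, `periodicEnergy_translate`; `⟨Ψ_P, AΨ_P⟩ = 0`):
       `|⟨Ψ₁, AΨ₂⟩| ≤ √K·(√h(Ψ₁)‖Ψ₂‖ + √h(Ψ₂)‖Ψ₁‖)`,  `K = 4C_X N/k̃²`,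
   and `⟨Λ†⟩_Φ = Σ_P ⟨g₁(n̂₀)Φ_{P+k}, A g₂(n̂₀)Φ_P⟩` for any split `g₁(j−1)g₂(j) = j^{-1/2}` (`g₂ = 1` against `Ψ₀` kills the
   spurious term of §2). Around `Ψ₀` (pencil `Φ = cos α·Ψ₀ + sin α·ζ̂`, `ζ̂` of momentum `k`; the susceptibility end `α → 0`)
   this reduces the crux to the sufficient condition
     (F) `h((n̂₀+1)^{-1/2}ζ̂) ≤ (C/(4C_X N))·h(ζ̂)` for the momentum-`k` states `ζ̂` with `h(ζ̂) < (n_k(Ψ₀)+1)k̃²/C` (others free),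
   whose main term is (F1) an inverse-moment CONDENSATE FLOOR `⟨ζ̂,(n̂₀+1)^{-1}ζ̂⟩ ≤ C/(4C_X N)` (on a sharp sector: `j+1 ≥ 4C_XN/C`,
   the Josephson factor again) and whose remainder is (F2) the pairing double commutator `½⟨[F,[V,F]]⟩ ≈ |E_pair|/(2x³N³)`
   against `h(ζ̂) ≥ gap_k`: (F2) needs a SPECTRAL GAP `gap_k ≳ |E_pair|/(x²N²) ~ ρ(v̂(0)−8πa)/(x²N)` (phonon `c_s·2π/L` would
   do; only `gap ≥ 0` is available). Away from `α → 0` the chord needs (F) along the whole path of perturbed ground states of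
   `H + s(Λ_θ+Λ_θ†)`, `0 ≤ s ≤ 2k̃²√N/C` (curvature + anchor ⇏ chord: TRIAGE-r1-2, DREFUTE). Bogoliubov values satisfy all of this
   with room (`σ² ~ N√(ρa³)`; ED j006865: `χ̃(X)/(x·χ̃(Λ)) ∈ [0.87, 1.00]`), but none of it is a theorem in the thermodynamic limit.
4. WHY NO CLEAN TRUE NON-CIRCULAR `H` EXISTS.
   (i) States with `h(Φ) ≥ N k̃²/C` are free (`|N·I|² ≤ N²‖Θ‖² ≤ N`: `stub_thetaNorm` + Cauchy–Schwarz, equivalently `Λ†Λ = n̂_k ≤ N`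
       — hypothesis `LNSSSourceBound` below). Any `n̂₀`-hypothesis must therefore cover ALL states with `h < N k̃²/C`.
   (ii) "All such states are condensed / have `Var n̂₀ ≤ C₂N`" is FALSE in the crux's regime `L ≫ ξ`: the Goldstone twists
       `Φ_A := e^{iAΣⱼ sin(p·xⱼ)}Ψ₀`, `p = 2πe₁/L` (trial states: `phaseMul`), have `h(Φ_A) = A²p²N/2` exactly (`phaseGain`,
       `j_{Ψ₀} = 0`, uniform density) and `⟨n̂₀⟩ = Σ_ℓ n_{ℓp}(Ψ₀)J_ℓ(A)² ≈ x J₀(A)² N + O(√(ρa)L) = o(N)` at `A = 2.405`, where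
       `h = 2.89·N(2π/L)² ≪ ρaN`; for window modes `k = 2πn/L` with `‖n‖∞² > 2π²A²C = 114·C` (e.g. `‖n‖∞ ≥ 2` at the sharp
       free constant `C = 1/4π²`) they are NOT free, violate (F1)/(★★) (`⟨(n̂₀+1)^{-1}⟩ = O(1) ≫ 1/N`), and satisfy the crux only by
       Bessel decoupling
       (`|⟨Λ_k†⟩|² ≈ N J_ℓ(A)² ≤ 2π²CA²N/ℓ²` for `k = ℓp`), which no `n̂₀`-hypothesis sees.
   (iii) Restricted to slack below the softest mode (`δ < N p²/C`), a floor + fluctuation hypothesis is plausible but is BEC for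
       near-minimisers with slack `δ_N = N/(C L²)` at EVERY `L ≥ (N/ρ₀)^{1/3}` simultaneously, in inverse-moment form, plus (F2)
       (pairing-fluctuation + gap) for the perturbed ground states: strictly stronger than `PeriodicBEC` (fixed `ρ`, `∃ δ > 0`,
       expectation `⟨n̂₀⟩ ≥ cN` only). Conversely S4 ∧ CNumberGD ⟹ crux ⟹ (GDTransfer) PeriodicBEC.
   (iv) The card's device (`CNumberGD` + KLS counting ⇒ `𝔼[x̂(1−x̂)] ≤ ε`; `Var n̂₀ ≤ C₂N` + Perron–Frobenius continuity in the
       coupling ⇒ `x(Ψ₀(t)) ≈ 1`) reaches only the exact ground state at fixed `(N, L)`; it gives neither (F1) for the other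
       low-energy momentum-`k` states nor (F2), nor anything along the `s`-path. "Var n̂₀ ≤ C₂N" is necessary-type, not sufficient.
5. WHAT IS KERNEL-CHECKED BELOW (sorry-free; NOT the registered stub, not landed):
   `gdCan_of_cnumberGD_of_transfer : CNumberGD → LNSSSourceBound → SourceTransfer → ∀ v M, ∃ ρ₀ C N₀, GDCanWith ρ₀ C N₀ v M`,
   `C = max (1/x₀) (4 C_X c_E/x₀)`, `ρ₀ = min`, `N₀ = max`: far states by `|N·I|² ≤ N`, near states by a comparison state `Φ'` with
   `√(x₀N)·N|I(Φ)| ≤ |X(Φ')|` and `h(Φ') ≤ c_E h(Φ)` (square form of `CNumberGD` at `Φ'`). `SourceTransfer` is implied by the crux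
   (twist comparison states) and implies it given `CNumberGD`: it is the crux in disguise — the formal shape of the circularity.
-/

noncomputable section

namespace Summit.AtomisticToContinuum.BoseEinsteinCondensation.Cruxes.GaussianDominationCan.WardChordSplitting

open MeasureTheory
open scoped ENNReal ComplexConjugate
open Literature.MathematicalPhysics.QuantumManyBody.BoseGas
open Summit.AtomisticToContinuum.BoseEinsteinCondensation.Theses
open Summit.AtomisticToContinuum.BoseEinsteinCondensation.Theorems.GaussianDominationCan.Negative

/-! ### Vocabulary of the line (pasted verbatim from `work/WardSplitDefs.lean`, to be imported from
`…BECThomsonPrincipleGaussianDominationCanWardSplitDefs` once that file lands) -/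

section Vocabulary

variable {N : ℕ} {L : ℝ}

/-- The wave vector `k = (2π/L)·n ∈ ℝ³`. -/
def kvec (L : ℝ) (n : Fin 3 → ℤ) : Space := WithLp.toLp 2 fun j => 2 * Real.pi / L * (n j : ℝ)

/-- `|k|² = (2π/L)² ∑ⱼ nⱼ²` (Euclidean). -/
def ksq (L : ℝ) (n : Fin 3 → ℤ) : ℝ := (2 * Real.pi / L) ^ 2 * ∑ j, (n j : ℝ) ^ 2

/-- The phase `k·x = (2π/L) ∑ⱼ nⱼ xⱼ` (literally the crux's exponent). -/
def karg (L : ℝ) (n : Fin 3 → ℤ) (x : Space) : ℝ := 2 * Real.pi / L * ∑ j, (n j : ℝ) * x j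

/-- **The c-number condensate source** `X(Φ) = ⟨Φ, ∑ᵢ e^{ik·xᵢ} Pᵢ Φ⟩ = ⟨Φ, a_k†a_0 Φ⟩`
(`Pᵢ` = cell average in particle `i` = the crux's `P`, here `cellAvg` of Negative/ProductCalculus; for
Bose-symmetric `Φ` this is `(m+1) ∫ conj Φ · e^{ik·x₀} · P₀Φ`). -/
def condensateSource (n : Fin 3 → ℤ) (Φ : PeriodicTrialState N L) : ℂ :=
  ∑ i : Fin N, ∫ X in cellN N L,
    (starRingEnd ℂ) (Φ.ψ X) * Complex.exp (Complex.I * (karg L n (X i) : ℂ)) * cellAvg N L i Φ.ψ X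

/-- **c-number Gaussian domination** (the line's intermediate statement; NOT a stub — it is DERIVED from S1–S3 by
`cnumberGD_of`): the chord for the c-number condensate source `X(Φ) = ⟨Φ, ∑ᵢ e^{ik·xᵢ}PᵢΦ⟩ = ⟨a_k†a_0⟩_Φ` with the
crux's budget `×N`: `E₀^per + s|X(Φ)| ≤ E_v(Φ) + C s² N L²/‖n‖∞²` (i.e. `|⟨a_k†a_0⟩|² ≤ 4CN(L/‖n‖∞)²(E - E₀)`,
Gaussian domination for `a_k†a_0/√N`, both quadratures). Bogoliubov: `x(u+v)²/e_k ≤ 1/k²` and `x k²/e_k² ≤ 1/k²`. -/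
def CNumberGD : Prop :=
  ∀ v : ℝ → ℝ≥0∞, IsRepulsiveFiniteRange v → ∀ M : ℝ, 0 < M →
    ∃ ρ₀ C : ℝ, 0 < ρ₀ ∧ 0 < C ∧ ∃ N₀ : ℕ, ∀ N : ℕ, N₀ ≤ N → ∀ L : ℝ, 0 < L → (N : ℝ) ≤ ρ₀ * L ^ 3 →
      ∀ n : Fin 3 → ℤ, n ≠ 0 → 2 * Real.pi * ‖(fun j => (n j : ℝ))‖ / L ≤ M * Real.sqrt (N / L ^ 3) →
      ∀ s : ℝ, 0 ≤ s → ∀ Φ : PeriodicTrialState N L,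
        periodicGroundStateEnergy v N L + ENNReal.ofReal (s * ‖condensateSource n Φ‖) ≤
          periodicEnergy v Φ + ENNReal.ofReal (C * s ^ 2 * N * L ^ 2 / ‖(fun j => (n j : ℝ))‖ ^ 2)

/-- **S4 — the normalisation lift (transfer `CNumberGD → GaussianDominationCan`; size L–XL, BEC-strength).**
(Docstring abridged; see `work/WardSplitDefs.lean`.) -/
def NormalisationLift : Prop :=
  CNumberGD → ∀ v : ℝ → ℝ≥0∞, IsRepulsiveFiniteRange v → ∀ M : ℝ, 0 < M →
    ∃ ρ₀ C : ℝ, 0 < ρ₀ ∧ 0 < C ∧ ∃ N₀ : ℕ, GDCanWith ρ₀ C N₀ v M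

end Vocabulary

/-! ### Chord ⇔ square lemmas (pasted verbatim from `work/WardSplitDefs.lean`) -/

section Lemmas

/-- Square form of a chord family: `a + sF ≤ e + cs²` for all `s ≥ 0` (`c > 0`, `F ≥ 0`) gives `F² ≤ 4c(e - a)`
(take `s = F/2c`). [folklore] -/
theorem sq_le_of_forall_chord {a e c F : ℝ} (hc : 0 < c) (hF : 0 ≤ F)
    (h : ∀ s : ℝ, 0 ≤ s → a + s * F ≤ e + c * s ^ 2) : F ^ 2 ≤ 4 * c * (e - a) := by
  have h1 := h (F / (2 * c)) (by positivity)
  have e1 : F / (2 * c) * F = 2 * (F ^ 2 / (4 * c)) := by field_simp; ring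
  have e2 : c * (F / (2 * c)) ^ 2 = F ^ 2 / (4 * c) := by field_simp; ring
  rw [e1, e2] at h1
  have h2 : F ^ 2 / (4 * c) ≤ e - a := by linarith
  have h3 := (div_le_iff₀ (by positivity : (0 : ℝ) < 4 * c)).mp h2
  linarith

/-- Reading an `ℝ≥0∞` chord at a finite-energy state as a real inequality. [folklore] -/
theorem ennreal_chord_iff {E₀ E : ℝ≥0∞} (hE : E ≠ ⊤) (hle : E₀ ≤ E) {x y : ℝ} (hx : 0 ≤ x) (hy : 0 ≤ y) :
    E₀ + ENNReal.ofReal x ≤ E + ENNReal.ofReal y ↔ E₀.toReal + x ≤ E.toReal + y := by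
  have hE₀ : E₀ ≠ ⊤ := ne_top_of_le_ne_top hE hle
  set a := E₀.toReal with ha
  set e := E.toReal with he
  rw [← ENNReal.ofReal_toReal hE₀, ← ENNReal.ofReal_toReal hE, ← ha, ← he,
    ← ENNReal.ofReal_add ENNReal.toReal_nonneg hx, ← ENNReal.ofReal_add ENNReal.toReal_nonneg hy,
    ENNReal.ofReal_le_ofReal_iff (by positivity)]

/-- The square form of an `ℝ≥0∞` chord family `E₀ + sF ≤ E + c s²` (all `s ≥ 0`) at a finite-energy state:
`F² ≤ 4c(E - E₀)`. [folklore] -/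
theorem sq_le_of_ennreal_chords {E₀ E : ℝ≥0∞} (hE : E ≠ ⊤) (hle : E₀ ≤ E) {F c : ℝ} (hF : 0 ≤ F)
    (hc : 0 < c)
    (h : ∀ s : ℝ, 0 ≤ s → E₀ + ENNReal.ofReal (s * F) ≤ E + ENNReal.ofReal (c * s ^ 2)) :
    F ^ 2 ≤ 4 * c * (E.toReal - E₀.toReal) :=
  sq_le_of_forall_chord hc hF fun s hs =>
    (ennreal_chord_iff hE hle (mul_nonneg hs hF) (by positivity)).mp (h s hs)

end Lemmas

/-! ### The algebraic skeleton of the lift under explicit transfer hypotheses -/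

section Lift

/-- **Hypothesis (B): the LNSS source is bounded by `√N`**: `(N·|I(Φ)|)² ≤ N`, i.e. `|⟨Φ, Λ_k†Φ⟩|² ≤ N` — the content of
`‖Θ‖² ≤ 1/N` (first lead's `stub_thetaNorm`) plus Cauchy–Schwarz `|I| ≤ ‖Φ‖·‖Θ‖` (in second quantisation: `Λ_k†Λ_k = n̂_k ≤ N`).
Taken here as an explicit hypothesis; it makes every state with `E(Φ) − E₀ ≥ x₀ N ‖n‖²/L²` ("far") satisfy the crux for free. -/
def LNSSSourceBound : Prop :=
  ∀ (m : ℕ) (L : ℝ), 0 < L → ∀ (n : Fin 3 → ℤ) (Φ : PeriodicTrialState (m + 1) L),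
    ((m + 1 : ℝ) * ‖sourceIntegral m L n Φ.ψ‖) ^ 2 ≤ (m + 1 : ℝ)

/-- **Hypothesis (T): source transfer by comparison states** — the formal shape of the normalisation lift
`1/√N ↦ n̂₀^{-1/2}`.  In the crux's regime, every finite-energy trial state `Φ` is either FAR
(`E(Φ) − E₀ ≥ x₀·N·‖n‖∞²/L²`, then (B) closes) or admits a comparison trial state `Φ'` whose c-number source dominates the
LNSS source of `Φ` with the Josephson gain `√(x₀N)` (`√(x₀ N)·N|I(Φ)| ≤ |X(Φ')|`) at comparable excess energy
(`E(Φ') − E₀ ≤ c_E (E(Φ) − E₀)`).  On a state with sharp `n̂₀ = j ≥ x₀N` one may take `Φ' = Φ` (`N·I = X/√j`); in general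
`Φ' ∝ (n̂₀+1)^{-1/2}`-reweighting of the momentum-`(P+k)` components of `Φ`, and the energy clause is the condensate-fraction /
`[V, n̂₀]`-fluctuation content of the crux (see the file header: this hypothesis is the crux in disguise). -/
def SourceTransfer : Prop :=
  ∀ v : ℝ → ℝ≥0∞, IsRepulsiveFiniteRange v → ∀ M : ℝ, 0 < M →
    ∃ ρ₁ x₀ cE : ℝ, 0 < ρ₁ ∧ 0 < x₀ ∧ 0 < cE ∧ ∃ N₁ : ℕ, ∀ m : ℕ, N₁ ≤ m + 1 → ∀ L : ℝ, 0 < L →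
      ((m + 1 : ℕ) : ℝ) ≤ ρ₁ * L ^ 3 → ∀ n : Fin 3 → ℤ, n ≠ 0 → InWindow M m L n →
      ∀ Φ : PeriodicTrialState (m + 1) L, periodicEnergy v Φ ≠ ⊤ →
        x₀ * (m + 1 : ℝ) * ‖(fun j => (n j : ℝ))‖ ^ 2 / L ^ 2 ≤
            (periodicEnergy v Φ).toReal - (periodicGroundStateEnergy v (m + 1) L).toReal ∨
        ∃ Φ' : PeriodicTrialState (m + 1) L, periodicEnergy v Φ' ≠ ⊤ ∧
          Real.sqrt (x₀ * (m + 1 : ℝ)) * ((m + 1 : ℝ) * ‖sourceIntegral m L n Φ.ψ‖) ≤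
            ‖condensateSource n Φ'‖ ∧
          (periodicEnergy v Φ').toReal - (periodicGroundStateEnergy v (m + 1) L).toReal ≤
            cE * ((periodicEnergy v Φ).toReal - (periodicGroundStateEnergy v (m + 1) L).toReal)

/-- **The lift, algebraic skeleton (kernel-checked):** c-number Gaussian domination, the `√N` bound on the LNSS source and
the source-transfer hypothesis give the crux in the disprover's named form `∀ v M, ∃ ρ₀ C N₀, GDCanWith ρ₀ C N₀ v M`
(`= BECThomsonPrinciple.GaussianDominationCan` by `gaussianDominationCan_iff`, `Iff.rfl`), with
`ρ₀ = min ρ_X ρ₁`, `N₀ = max N_X N₁`, `C = max (1/x₀) (4 C_X c_E/x₀)` — the Josephson factor `1/x₀` explicit.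
Far states: `(N|I|)² ≤ N ≤ (1/x₀)(L²/‖n‖²)(E − E₀)`; near states: `x₀N(N|I|)² ≤ |X(Φ')|² ≤ 4 C_X N (L²/‖n‖²)(E(Φ') − E₀)
≤ 4 C_X N (L²/‖n‖²) c_E (E(Φ) − E₀)` (square form of `CNumberGD` at `Φ'`, `sq_le_of_ennreal_chords`), and back to the chord by
`forall_gdIneq_iff`. [folklore] -/
theorem gdCan_of_cnumberGD_of_transfer (hX : CNumberGD) (hB : LNSSSourceBound) (hT : SourceTransfer) :
    ∀ v : ℝ → ℝ≥0∞, IsRepulsiveFiniteRange v → ∀ M : ℝ, 0 < M →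
      ∃ ρ₀ C : ℝ, 0 < ρ₀ ∧ 0 < C ∧ ∃ N₀ : ℕ, GDCanWith ρ₀ C N₀ v M := by
  intro v hv M hM
  obtain ⟨ρX, CX, hρX, hCX, NX, hGX⟩ := hX v hv M hM
  obtain ⟨ρ₁, x₀, cE, hρ₁, hx₀, hcE, N₁, hTr⟩ := hT v hv M hM
  have hC₁ : 0 < 1 / x₀ := by positivity
  refine ⟨min ρX ρ₁, max (1 / x₀) (4 * CX * cE / x₀), lt_min hρX hρ₁, lt_max_of_lt_left hC₁,
    max NX N₁, ?_⟩
  intro m hm L hL hd n hn hw s hs Φ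
  set C : ℝ := max (1 / x₀) (4 * CX * cE / x₀) with hCdef
  have hC : 0 < C := lt_max_of_lt_left hC₁
  have hmX : NX ≤ m + 1 := (le_max_left _ _).trans hm
  have hm₁ : N₁ ≤ m + 1 := (le_max_right _ _).trans hm
  have hL3 : (0 : ℝ) ≤ L ^ 3 := by positivity
  have hdX : ((m + 1 : ℕ) : ℝ) ≤ ρX * L ^ 3 := hd.trans (mul_le_mul_of_nonneg_right (min_le_left _ _) hL3)
  have hd₁ : ((m + 1 : ℕ) : ℝ) ≤ ρ₁ * L ^ 3 := hd.trans (mul_le_mul_of_nonneg_right (min_le_right _ _) hL3)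
  refine (forall_gdIneq_iff hC hL hn Φ).mpr (fun hE => ?_) s hs
  -- notation
  have hnorm : 0 < ‖(fun j => (n j : ℝ))‖ := lt_of_lt_of_le one_pos (one_le_norm_intVec hn)
  set q : ℝ := L ^ 2 / ‖(fun j => (n j : ℝ))‖ ^ 2 with hq
  have hq0 : 0 < q := by positivity
  have hE₀E : periodicGroundStateEnergy v (m + 1) L ≤ periodicEnergy v Φ := periodicGroundStateEnergy_le v Φ
  set d : ℝ := (periodicEnergy v Φ).toReal - (periodicGroundStateEnergy v (m + 1) L).toReal with hddef
  have hd0 : 0 ≤ d := sub_nonneg.mpr (ENNReal.toReal_mono hE hE₀E)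
  rw [ENNReal.toReal_sub_of_le hE₀E hE, ← hddef]
  have hN : (0 : ℝ) < (m + 1 : ℝ) := by positivity
  have hT0 : 0 ≤ (m + 1 : ℝ) * ‖sourceIntegral m L n Φ.ψ‖ := by positivity
  have hCq : C * L ^ 2 / ‖(fun j => (n j : ℝ))‖ ^ 2 = C * q := by rw [hq]; ring
  rw [hCq]
  rcases hTr m hm₁ L hL hd₁ n hn hw Φ hE with hfar | ⟨Φ', hE', hsrc, hen⟩
  · -- far states: `T² ≤ N ≤ (1/x₀) q (x₀ N ‖n‖²/L²) ≤ (1/x₀) q d ≤ C q d`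
    have h1 : ((m + 1 : ℝ) * ‖sourceIntegral m L n Φ.ψ‖) ^ 2 ≤ (m + 1 : ℝ) := hB m L hL n Φ
    have h2 : (m + 1 : ℝ) = (1 / x₀) * q * (x₀ * (m + 1 : ℝ) * ‖(fun j => (n j : ℝ))‖ ^ 2 / L ^ 2) := by
      rw [hq]; field_simp
    have h3 : (1 / x₀) * q * (x₀ * (m + 1 : ℝ) * ‖(fun j => (n j : ℝ))‖ ^ 2 / L ^ 2) ≤ (1 / x₀) * q * d :=
      mul_le_mul_of_nonneg_left hfar (by positivity)
    have h4 : (1 / x₀) * q * d ≤ C * q * d :=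
      mul_le_mul_of_nonneg_right (mul_le_mul_of_nonneg_right (le_max_left _ _) hq0.le) hd0
    linarith
  · -- near states: square form of `CNumberGD` at the comparison state `Φ'`
    have hE₀E' : periodicGroundStateEnergy v (m + 1) L ≤ periodicEnergy v Φ' := periodicGroundStateEnergy_le v Φ'
    set d' : ℝ := (periodicEnergy v Φ').toReal - (periodicGroundStateEnergy v (m + 1) L).toReal with hd'def
    have hcX : 0 < CX * (m + 1 : ℝ) * q := by positivity
    have hsq : ‖condensateSource n Φ'‖ ^ 2 ≤ 4 * (CX * (m + 1 : ℝ) * q) * d' :=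
      sq_le_of_ennreal_chords hE' hE₀E' (norm_nonneg _) hcX fun s' hs' => by
        have h := hGX (m + 1) hmX L hL hdX n hn hw s' hs' Φ'
        have e : CX * s' ^ 2 * ((m + 1 : ℕ) : ℝ) * L ^ 2 / ‖(fun j => (n j : ℝ))‖ ^ 2 =
            CX * (m + 1 : ℝ) * q * s' ^ 2 := by
          rw [hq]; push_cast; ring
        rwa [e] at h
    -- `x₀ N T² ≤ |X(Φ')|² ≤ 4 C_X N q d' ≤ 4 C_X N q c_E d`
    have h0 : 0 ≤ Real.sqrt (x₀ * (m + 1 : ℝ)) * ((m + 1 : ℝ) * ‖sourceIntegral m L n Φ.ψ‖) := by positivity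
    have h1 := pow_le_pow_left₀ h0 hsrc 2
    rw [mul_pow, Real.sq_sqrt (by positivity : (0 : ℝ) ≤ x₀ * (m + 1 : ℝ))] at h1
    have h2 : 4 * (CX * (m + 1 : ℝ) * q) * d' ≤ 4 * (CX * (m + 1 : ℝ) * q) * (cE * d) :=
      mul_le_mul_of_nonneg_left hen (by positivity)
    have h3 : x₀ * (m + 1 : ℝ) * ((m + 1 : ℝ) * ‖sourceIntegral m L n Φ.ψ‖) ^ 2 ≤
        x₀ * (m + 1 : ℝ) * ((4 * CX * cE / x₀) * q * d) := by
      have e : 4 * (CX * (m + 1 : ℝ) * q) * (cE * d) = x₀ * (m + 1 : ℝ) * ((4 * CX * cE / x₀) * q * d) := by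
        field_simp
      linarith
    have h4 : ((m + 1 : ℝ) * ‖sourceIntegral m L n Φ.ψ‖) ^ 2 ≤ (4 * CX * cE / x₀) * q * d :=
      le_of_mul_le_mul_left h3 (by positivity)
    have h5 : (4 * CX * cE / x₀) * q * d ≤ C * q * d :=
      mul_le_mul_of_nonneg_right (mul_le_mul_of_nonneg_right (le_max_right _ _) hq0.le) hd0
    linarith

/-- **Corollary: the lift stated against the route decl.** [folklore] -/
theorem gaussianDominationCan_of_cnumberGD_of_transfer (hX : CNumberGD) (hB : LNSSSourceBound)
    (hT : SourceTransfer) : BECThomsonPrinciple.GaussianDominationCan :=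
  gaussianDominationCan_iff.mpr (gdCan_of_cnumberGD_of_transfer hX hB hT)

end Lift

end Summit.AtomisticToContinuum.BoseEinsteinCondensation.Cruxes.GaussianDominationCan.WardChordSplitting

end
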